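import Literature.NumberTheory.GaloisRepresentations.LAdicRepFrobenius
import Literature.NumberTheory.GaloisRepresentations.ChebotarevArtinRep
import Literature.NumberTheory.GaloisRepresentations.ResidualRepRestrict
import Literature.NumberTheory.GaloisRepresentations.FramedRepBaseChange
import Literature.NumberTheory.GaloisRepresentations.TateTwistFrobeniusProofs
import Literature.RepresentationTheory.Semisimple.IrreducibleOfCharpoly
import Literature.NumberTheory.EllipticCurves.HasseWeilGoodReductionProofs
import Literature.NumberTheory.EllipticCurves.GoodReductionUnramifiedProofs
import Literature.NumberTheory.EllipticCurves.LFunctionPrimeCoeff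
import Literature.NumberTheory.EllipticCurves.TateModuleContinuityProofs
import Literature.NumberTheory.EllipticCurves.TateModuleFinrankProofs
import Literature.NumberTheory.EllipticCurves.ComplexMultiplicationLFunctionIsogenyProofs
import Literature.NumberTheory.EllipticCurves.NewformGaloisRep
import Literature.NumberTheory.EllipticCurves.HasseWeilGoodReduction
import HarnessLib

/-!
# Euler factors of `V_ℓ(E) ⊗ ψ` are those of the twisted newform (modulo Carayol)

For an elliptic curve `E/ℚ` with newform `f_E`, a Dirichlet character `χ` and the newform
`g = (f_E ⊗ χ)^{new}` (`a_p(g) = χ(p) a_p(E)`, `ε_g = χ²` at almost all `p`), the `ℓ`-adic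
representation `ρ_{g,ℓ} : Γ_ℚ → GL₂(ℚ̄_ℓ)` attached to `g` (Deligne) is isomorphic to
`(V_ℓ(E) ⊗ ℚ̄_ℓ) ⊗ ψ_χ`, `ψ_χ` the Galois character of `χ`
(`nonempty_equiv_twist_of_isGaloisRepOfNewform1`): both have the Frobenius polynomials
`X² - χ(p) a_p X + χ(p)² p` at almost all `p`, and `ρ_{g,ℓ}` is irreducible, which suffices by the
Brauer–Nesbitt/Chebotarev recognition theorem *for one irreducible and one arbitrary
representation* (`FramedGaloisRep.nonempty_equiv_of_hasFrobCharpolyAt_of_finite_of_isIrreducible`: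
traces and determinants agree on the dense Frobenii — Chebotarev is proved in the tree,
`chebotarevArtinRep_holds` — hence everywhere, so the second representation is irreducible too by
`isIrreducible_of_charpoly_eq`, and Deligne–Serre's Lemme 3.2 in the tree's form
`FramedGaloisRep.nonempty_equiv_of_hasFrobCharpolyAt_of_finite` applies; no semisimplicity of
`V_ℓ(E)` is needed).  Consequently, **assuming Carayol's theorem (A) in Euler-factor form**
(hypothesis `hC` of `map_reverse_charpoly_toInertiaCoinvariants_twist_eq`, the statement that the
coinvariant Euler factors `det(1 - Frob T | (ρ_g)_{I_𝔓})` of the `ℓ`-adic representation of a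
newform of weight `k ≥ 2` are its Hecke Euler factors `1 - a_p T + ε(p) p^{k-1} T²` at every `p ≠ ℓ`:
Carayol, ASENS 1986, Thm. (A); Rohrlich 1997, §3.1 and §3.8 Thm. 5; not yet a named fact of the
tree, hence carried as a hypothesis), the Euler factors of `(V_ℓ(E) ⊗ ℚ̄_ℓ) ⊗ ψ_χ` at every
`p ≠ ℓ` — including the primes of additive reduction — are `1 - a_p(g) T + ε_g(p) p T²`.

Also: a framed model of `V_ℓ(E)` with its Frobenius data at the good primes
(`exists_framedGaloisRep_rationalTate`, from the tree's Tate-module theorems), and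
`a_p(E) = a_v` for Mathlib's `LFunction` at a good prime (`LFunction_primesEquiv_eq_frobeniusTraceAt`).
Everything is proved; no definitions; the only non-discharged input is the hypothesis `hC`.
This is the Galois-side input "`L(E ⊗ χ, s)` has the Euler factors of `g`" for the reduction of
`hasEntireLFunction_baseChange_fixedField` (`AnalyticRankOverNumberField`) to modularity.

## References

* P. Deligne, J.-P. Serre, *Formes modulaires de poids 1*, ASENS 7 (1974), Lemme 3.2 (p. 513).
  [DeligneSerreASENS1974]
* H. Carayol, *Sur les représentations ℓ-adiques associées aux formes modulaires de Hilbert*,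
  ASENS 19 (1986), Thm. (A), (0.5), (0.8), pp. 410–411. [CarayolASENS1986]
* D. E. Rohrlich, *Modular curves, Hecke correspondences, and L-functions*, in Cornell–Silverman–
  Stevens (1997), §3.1 (PDF pp. 131–132), §3.8 Thm. 5 (PDF p. 152). [Rohrlich1997]
* J.-P. Serre, *Abelian ℓ-adic representations and elliptic curves* (1968), Ch. I §2.3.
  [SerreAbelianLadic1968]
* J. H. Silverman, *The Arithmetic of Elliptic Curves*, 2nd ed., C.21 Remark 21.3, §C.16.
  [SilvermanAEC2009]

## Mathlib / tree search

Tree: `FramedGaloisRep.nonempty_equiv_of_hasFrobCharpolyAt_of_finite` (`LAdicRepFrobenius`),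
`chebotarevArtinRep_holds` (`ChebotarevArtinRep`), `isIrreducible_of_charpoly_eq`
(`RepresentationTheory/Semisimple/IrreducibleOfCharpoly`), `isSemisimpleRepresentation_of_isIrreducible`
(`ResidualRepRestrict`), `FramedGaloisRep.isUnramifiedAt_twist` (`TateTwistFrobeniusProofs`),
`hasFrobCharpolyAt_rationalTateGaloisRepOf_of_hasGoodReductionAt` with
`trace/det_galoisRepTate_frobenius_of_hasGoodReductionAt_holds`, `isUnramifiedAt_rationalTateGaloisRepOf_geomPoints`,
`ContinuousRep.frame`, `GaloisRep.isUnramifiedAt_frame_iff`, `hasFrobCharpolyAt_frame_iff`,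
`ContinuousRep.inertiaCoinvariantsCongr_conj_toInertiaCoinvariants`, `IsGaloisRepOfNewform1`,
`map_heckePolynomial`.  `lean search 'nonempty_equiv.*isIrreducible|twist.*IsGaloisRepOfNewform1'`: no prior hits.
-/

noncomputable section

open scoped NumberField Polynomial MatrixGroups
open NumberField IsDedekindDomain IsDedekindDomain.HeightOneSpectrum Field Polynomial
  Rat.HeightOneSpectrum
  Literature.NumberTheory.GaloisRepresentations Literature.NumberTheory.EllipticCurves

namespace Literature.NumberTheory.EllipticCurves

/-! ### Irreducible `2`-dimensional Galois representations are determined by Frobenius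
characteristic polynomials among all representations -/

section BrauerNesbitt

variable {K : Type} [Field K] [NumberField K] {A : Type*} [Field A] [TopologicalSpace A]
  [IsTopologicalRing A]

omit [NumberField K] [IsTopologicalRing A] in
/-- The characteristic polynomial of a `2 × 2` matrix representation at `σ` in terms of trace and
determinant. [folklore] -/
theorem FramedGaloisRep.charpoly_eq_of_two (r : FramedGaloisRep K A 2) (σ : absoluteGaloisGroup K) :
    FramedRep.charpoly r σ = X ^ 2 - C (FramedRep.trace r σ) * X +
      C (Matrix.GeneralLinearGroup.det (r σ) : A) := by
  rw [FramedRep.charpoly, Matrix.charpoly_fin_two, FramedRep.trace, Matrix.trace_fin_two,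
    Matrix.det_fin_two, Matrix.GeneralLinearGroup.val_det_apply, Matrix.det_fin_two]

/-- **An irreducible two-dimensional Galois representation is determined, among all continuous
two-dimensional representations, by its Frobenius characteristic polynomials at almost all
places.**  Let `K` be a number field, `A` a Hausdorff topological field of characteristic `0`,
`r, r' : Γ_K → GL₂(A)` continuous with `r` irreducible, and suppose that off a finite set `S` of
places both are unramified with a common characteristic polynomial of Frobenius.  Then
`r ≃ r'`.  Proof: the traces and determinants of `r` and `r'` are continuous and agree on the
dense set of Frobenius elements (Chebotarev, proved in the tree: `chebotarevArtinRep_holds`,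
`absoluteGaloisGroup.frobenius_dense`), hence everywhere, so `r` and `r'` have the same
characteristic polynomials at every `σ ∈ Γ_K`; by Brauer–Nesbitt in the form
"irreducibility is detected by characteristic polynomials" (`isIrreducible_of_charpoly_eq`) `r'` is
irreducible too, so both are semisimple and `FramedGaloisRep.nonempty_equiv_of_hasFrobCharpolyAt_of_finite`
(Deligne–Serre 1974, Lemme 3.2) applies.  (This is how the `λ`-adic representation of a newform is
recognised from `V_ℓ(E) ⊗ χ` without knowing the semisimplicity of the latter.)
[cite: DeligneSerreASENS1974, Lemme 3.2 (p. 513)] [cite: BourbakiAlgebreVIII2012, VIII § 20 n° 6, Thm. 2, Cor. 1 (p. 378)] -/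
theorem FramedGaloisRep.nonempty_equiv_of_hasFrobCharpolyAt_of_finite_of_isIrreducible
    [T2Space A] [CharZero A] {S : Set (HeightOneSpectrum (𝓞 K))} (hS : S.Finite)
    (r r' : FramedGaloisRep K A 2) (hr : r.toGaloisRep.IsIrreducible)
    (hST : ∀ v ∉ S, r.IsUnramifiedAt v ∧ r'.IsUnramifiedAt v ∧
      ∃ P : Polynomial A, r.HasFrobCharpolyAt v P ∧ r'.HasFrobCharpolyAt v P) :
    Nonempty (ContinuousRep.Equiv r.toGaloisRep r'.toGaloisRep) := by
  classical
  have hC : Automorphic.chebotarev_artinRep := chebotarevArtinRep_holds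
  set D : Set (absoluteGaloisGroup K) :=
    {σ | ∃ v ∉ S, ∃ 𝔓 ∈ v.primesAbove, IsArithFrobAt (𝓞 K) σ 𝔓} with hDdef
  -- characteristic polynomials agree on the Frobenius elements over good places
  have hF : D ⊆ {σ | FramedRep.charpoly r σ = FramedRep.charpoly r' σ} := by
    rintro σ ⟨v, hv, 𝔓, h𝔓, hσ⟩
    obtain ⟨-, -, P, hP, hP'⟩ := hST v hv
    exact (hP 𝔓 h𝔓 σ hσ).trans (hP' 𝔓 h𝔓 σ hσ).symm
  have hFt : D ⊆ {σ | FramedRep.trace r σ = FramedRep.trace r' σ} := fun σ hσ => by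
    have h := hF hσ
    simp only [Set.mem_setOf_eq, FramedGaloisRep.charpoly_eq_of_two] at h ⊢
    have h1 := congrArg (fun P : A[X] => P.coeff 1) h
    simp only [coeff_add, coeff_sub, coeff_X_pow, coeff_C_mul, coeff_X_one, coeff_C,
      if_neg (show (1 : ℕ) ≠ 2 by norm_num), if_neg (show (1 : ℕ) ≠ 0 by norm_num)] at h1
    simpa using h1
  have hFd : D ⊆ {σ | (Matrix.GeneralLinearGroup.det (r σ) : A) =
      Matrix.GeneralLinearGroup.det (r' σ)} := fun σ hσ => by
    have h := hF hσ
    simp only [Set.mem_setOf_eq, FramedGaloisRep.charpoly_eq_of_two] at h ⊢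
    have h0 := congrArg (fun P : A[X] => P.coeff 0) h
    simp only [coeff_add, coeff_sub, coeff_X_pow, coeff_C_mul, coeff_X_zero, coeff_C_zero,
      if_neg (show (0 : ℕ) ≠ 2 by norm_num), mul_zero, sub_zero] at h0
    simpa using h0
  -- both coincidence sets are closed and contain a dense set
  have hdense : Dense D := absoluteGaloisGroup.frobenius_dense hC K S hS
  have hct : ∀ σ, FramedRep.trace r σ = FramedRep.trace r' σ := fun σ =>
    (isClosed_eq (FramedRep.continuous_trace r) (FramedRep.continuous_trace r')).closure_subset_iff.2
      hFt (by rw [hdense.closure_eq]; exact Set.mem_univ σ)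
  have hcd : ∀ σ, (Matrix.GeneralLinearGroup.det (r σ) : A) =
      Matrix.GeneralLinearGroup.det (r' σ) := fun σ => by
    have hc : Continuous fun σ => (Matrix.GeneralLinearGroup.det (r σ) : A) :=
      Units.continuous_val.comp (map_continuous (FramedRep.det r))
    have hc' : Continuous fun σ => (Matrix.GeneralLinearGroup.det (r' σ) : A) :=
      Units.continuous_val.comp (map_continuous (FramedRep.det r'))
    exact (isClosed_eq hc hc').closure_subset_iff.2 hFd (by rw [hdense.closure_eq]; exact Set.mem_univ σ)
  have hall : ∀ σ, FramedRep.charpoly r' σ = FramedRep.charpoly r σ := fun σ => by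
    rw [FramedGaloisRep.charpoly_eq_of_two, FramedGaloisRep.charpoly_eq_of_two, hct, hcd]
  -- `r'` is irreducible
  have hr' : r'.toGaloisRep.IsIrreducible :=
    Literature.RepresentationTheory.Semisimple.isIrreducible_of_charpoly_eq
      (r' : absoluteGaloisGroup K →* GL (Fin 2) A) (r : absoluteGaloisGroup K →* GL (Fin 2) A)
      hall hr
  exact FramedGaloisRep.nonempty_equiv_of_hasFrobCharpolyAt_of_finite hC hS r r'
    (isSemisimpleRepresentation_of_isIrreducible hr)
    (isSemisimpleRepresentation_of_isIrreducible hr') hST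

end BrauerNesbitt

/-! ### A framed model of `V_ℓ(E)` with its Frobenius data -/

section Frame

open WeierstrassCurve

/-- **`a_p(E) = a_v`**: at a prime `p` of good reduction the `p`-th coefficient of `L(E, s)` is the
trace of Frobenius `a_v = p + 1 - #Ẽ_v(𝔽_p)` of the place `v` over `p` (Mathlib's `LFunction`,
the tree's `frobeniusTraceAt`, both computed on Mathlib's chosen local minimal model at `v`).
[cite: SilvermanAEC2009, §C.16 (definition of L_v(T)), PDF p. 390] -/
theorem LFunction_primesEquiv_eq_frobeniusTraceAt (W : WeierstrassCurve ℚ)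
    (v : HeightOneSpectrum (𝓞 ℚ)) (hv : W.HasGoodReductionAt v) :
    W.LFunction (primesEquiv v : ℕ) = W.frobeniusTraceAt v := by
  have hp := (primesEquiv v).2
  rw [W.LFunction_apply_prime hp, finsum_eq_single _ v fun w hw ↦ ?_]
  · rw [localEulerFactor_apply_prime _ _ hp, if_pos (WeierstrassCurve.natCard_residueField_adicCompletionIntegers v),
      localPowerSeries, PowerSeries.coeff_one_invOfUnit_one]
    have h : localPolynomial (v.adicCompletionIntegers ℚ) (W.baseChange (v.adicCompletion ℚ)) =
        W.localPolynomialAt v := rfl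
    rw [h, W.localPolynomialAt_of_hasGoodReductionAt hv]
    simp [PowerSeries.coeff_mul_X_pow']
  · rw [localEulerFactor_apply_prime _ _ hp, if_neg]
    rw [WeierstrassCurve.natCard_residueField_adicCompletionIntegers, ← Subtype.ext_iff]
    exact fun h ↦ hw (primesEquiv.injective h)

/-- **A framed model of `V_ℓ(E)` with its Frobenius data.**  For an elliptic curve `E/ℚ` and a
prime `ℓ` there is a framed continuous representation `V : Γ_ℚ → GL₂(ℚ_ℓ)` together with a
`Γ_ℚ`-equivariant isomorphism `ℚ_ℓ² ≅ V_ℓ(E)` (a frame of the Tate-module representation,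
`ContinuousRep.frame`) such that at every prime `p ≠ ℓ` of good reduction `V` is unramified with
Frobenius characteristic polynomial `X² - a_p(E) X + p`, `a_p(E)` the `p`-th coefficient of
`L(E, s)` (the tree's theorems `isUnramifiedAt_rationalTateGaloisRepOf_geomPoints`,
`hasFrobCharpolyAt_rationalTateGaloisRepOf_of_hasGoodReductionAt` with the discharged
`trace/det_galoisRepTate_frobenius_of_hasGoodReductionAt`, and
`LFunction_primesEquiv_eq_frobeniusTraceAt`).
[cite: SilvermanAEC2009, C.21 Remark 21.3] -/
theorem exists_framedGaloisRep_rationalTate (W : WeierstrassCurve ℚ) [W.IsElliptic]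
    (ℓ : ℕ) [Fact ℓ.Prime] :
    ∃ (VQ : FramedGaloisRep ℚ ℚ_[ℓ] 2) (eV : (Fin 2 → ℚ_[ℓ]) ≃ₗ[ℚ_[ℓ]] W.rationalTateModule ℓ),
      (∀ (σ : absoluteGaloisGroup ℚ) (x : Fin 2 → ℚ_[ℓ]),
        eV (FramedRep.toRepresentation VQ σ x) = W.rationalGaloisRepTate ℓ σ (eV x)) ∧
      ∀ v : HeightOneSpectrum (𝓞 ℚ), (ℓ : 𝓞 ℚ) ∉ v.asIdeal → W.HasGoodReductionAt v →
        FramedGaloisRep.IsUnramifiedAt v VQ ∧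
          FramedGaloisRep.HasFrobCharpolyAt v
            (X ^ 2 - C ((W.LFunction (primesEquiv v : ℕ) : ℤ) : ℚ_[ℓ]) * X +
              C ((primesEquiv v : ℕ) : ℚ_[ℓ])) VQ := by
  haveI := W.module_finite_rationalTateModule_holds ℓ
  have hcW := W.continuous_rationalGaloisRepTate_holds ℓ
  set ρ := rationalTateGaloisRepOf (WeierstrassCurve.geomPoints W) ℓ hcW with hρ
  have h2 : Module.finrank ℚ_[ℓ] (W.rationalTateModule ℓ) = 2 :=
    W.finrank_rationalTateModule_eq_two_holds ℓ (Nat.cast_ne_zero.mpr (Fact.out : ℓ.Prime).ne_zero)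
  set b : Module.Basis (Fin 2) ℚ_[ℓ] (W.rationalTateModule ℓ) := Module.finBasisOfFinrankEq _ _ h2
    with hb
  refine ⟨ρ.frame b, b.equivFun.symm, fun σ x ↦ ?_, fun v hℓ hv ↦ ⟨?_, ?_⟩⟩
  · rw [FramedRep.toRepresentation_apply_apply, ContinuousRep.coe_frame_apply]
    obtain ⟨y, rfl⟩ := b.equivFun.surjective x
    rw [Module.Basis.equivFun_apply, LinearMap.toMatrix_mulVec_repr, ← Module.Basis.equivFun_apply,
      ← Module.Basis.equivFun_apply, LinearEquiv.symm_apply_apply, LinearEquiv.symm_apply_apply]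
    rfl
  · exact (GaloisRep.isUnramifiedAt_frame_iff v ρ b).mpr
      (W.isUnramifiedAt_rationalTateGaloisRepOf_geomPoints ℓ hcW hv hℓ)
  · have key := (GaloisRep.hasFrobCharpolyAt_frame_iff v ρ b _).mpr
      (W.hasFrobCharpolyAt_rationalTateGaloisRepOf_of_hasGoodReductionAt
        (W.trace_galoisRepTate_frobenius_of_hasGoodReductionAt_holds ℓ)
        (W.det_galoisRepTate_frobenius_of_hasGoodReductionAt_holds ℓ) hcW hℓ hv)
    rw [WeierstrassCurve.natCard_residueField_adicCompletionIntegers v,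
      ← LFunction_primesEquiv_eq_frobeniusTraceAt W v hv] at key
    convert key using 2

end Frame

/-! ### Twisting a two-dimensional representation: Frobenius data -/

section Twist2

variable {K : Type} [Field K] {F : Type*} [Field F] [TopologicalSpace F] [IsTopologicalRing F]

/-- **Frobenius characteristic polynomial of a twist, rank two.**  If the arithmetic Frobenii above
`v` have characteristic polynomial `X² - tX + d` on `ρ` and the character `χ` takes the value `c`
on them, then they have characteristic polynomial `X² - ctX + c²d` on `ρ ⊗ χ`.
[cite: SerreAbelianLadic1968, Ch. I §2.3] -/
theorem FramedGaloisRep.hasFrobCharpolyAt_twist_two {v : HeightOneSpectrum (𝓞 K)}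
    {ρ : FramedGaloisRep K F 2} {t d : F} (hρ : ρ.HasFrobCharpolyAt v (X ^ 2 - C t * X + C d))
    {χ : absoluteGaloisGroup K →ₜ* Fˣ} {c : F}
    (hχ : ∀ 𝔓 ∈ v.primesAbove, ∀ σ : absoluteGaloisGroup K, IsArithFrobAt (𝓞 K) σ 𝔓 →
      (χ σ : F) = c) :
    FramedGaloisRep.HasFrobCharpolyAt v (X ^ 2 - C (c * t) * X + C (c ^ 2 * d))
      (FramedRep.twist ρ χ) := by
  intro 𝔓 h𝔓 σ hσ
  have h := hρ 𝔓 h𝔓 σ hσ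
  rw [FramedRep.charpoly, Matrix.charpoly_fin_two] at h
  have ht : ((ρ σ : GL (Fin 2) F) : Matrix (Fin 2) (Fin 2) F).trace = t := by
    have h1 := congrArg (fun P : F[X] => P.coeff 1) h
    simp only [coeff_add, coeff_sub, coeff_X_pow, coeff_C_mul, coeff_X_one, coeff_C,
      if_neg (show (1 : ℕ) ≠ 2 by norm_num), if_neg (show (1 : ℕ) ≠ 0 by norm_num)] at h1
    simpa using h1
  have hd : ((ρ σ : GL (Fin 2) F) : Matrix (Fin 2) (Fin 2) F).det = d := by
    have h0 := congrArg (fun P : F[X] => P.coeff 0) h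
    simp only [coeff_add, coeff_sub, coeff_X_pow, coeff_C_mul, coeff_X_zero, coeff_C_zero,
      if_neg (show (0 : ℕ) ≠ 2 by norm_num), mul_zero, sub_zero] at h0
    simpa using h0
  change Matrix.charpoly ((FramedRep.twist ρ χ σ : GL (Fin 2) F) : Matrix (Fin 2) (Fin 2) F) = _
  rw [FramedRep.coe_twist_apply, hχ 𝔓 h𝔓 σ hσ, Matrix.charpoly_fin_two, Matrix.trace_smul,
    Matrix.det_smul, ht, hd, Fintype.card_fin, smul_eq_mul]

end Twist2

/-! ### `V_ℓ(E) ⊗ ψ` is the `ℓ`-adic representation of the twisted newform -/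

section Identification

open WeierstrassCurve Literature.NumberTheory.EllipticCurves.ModularForms CongruenceSubgroup

set_option maxHeartbeats 800000 in
/-- **`V_ℓ(E) ⊗ ψ ≅ ρ_{g,ℓ}` for the twisted newform `g`.**  Let `E/ℚ` be an elliptic curve with a
framed model `V` of `V_ℓ(E)` (unramified with Frobenius polynomial `X² - a_p(E)X + p` at the good
`p ≠ ℓ`), `ψ : Γ_ℚ → ℚ̄_ℓˣ` a continuous character unramified outside `m` whose arithmetic
Frobenii at `p ∤ m` take the values `ι⁻¹(χ₀(p))`, and `g ∈ S₂(Γ₁(N_g))` a form whose prime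
coefficients and nebentypus are `a_p(g) = χ₀(p) a_p(E)`, `ε_g(p) = χ₀(p)²` off a finite set of
primes (the newform attached to `f_E ⊗ χ`), with an irreducible `ℓ`-adic representation `ρ_g`
attached to `g` away from `N_g ℓ` (`IsGaloisRepOfNewform1`, e.g. from Deligne's theorem).  Then
`ρ_g ≃ (V ⊗ ℚ̄_ℓ) ⊗ ψ` as continuous representations of `Γ_ℚ`: both have Frobenius polynomial
`X² - ι⁻¹(χ₀(p)) a_p X + ι⁻¹(χ₀(p))² p` at almost all `p`, and `ρ_g` is irreducible
(`FramedGaloisRep.nonempty_equiv_of_hasFrobCharpolyAt_of_finite_of_isIrreducible`).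
[cite: DeligneSerreASENS1974, Lemme 3.2 (p. 513)] [cite: Rohrlich1997, §3.8 Thm. 5 (PDF p. 152)] -/
theorem nonempty_equiv_twist_of_isGaloisRepOfNewform1 (W : WeierstrassCurve ℚ) [W.IsElliptic]
    (ℓ : ℕ) [Fact ℓ.Prime] (ι : PadicAlgCl ℓ ≃+* ℂ) (VQ : FramedGaloisRep ℚ ℚ_[ℓ] 2)
    (hV : ∀ v : HeightOneSpectrum (𝓞 ℚ), (ℓ : 𝓞 ℚ) ∉ v.asIdeal → W.HasGoodReductionAt v →
      FramedGaloisRep.IsUnramifiedAt v VQ ∧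
        FramedGaloisRep.HasFrobCharpolyAt v
          (X ^ 2 - C ((W.LFunction (primesEquiv v : ℕ) : ℤ) : ℚ_[ℓ]) * X +
            C ((primesEquiv v : ℕ) : ℚ_[ℓ])) VQ)
    (m : ℕ) [NeZero m] (χ₀ : ℕ → ℂ) (ψ : absoluteGaloisGroup ℚ →ₜ* (PadicAlgCl ℓ)ˣ)
    (hψI : ∀ v : HeightOneSpectrum (𝓞 ℚ), ¬ ((primesEquiv v : Nat.Primes) : ℕ) ∣ m →
      ∀ 𝔓 ∈ v.primesAbove, ∀ σ ∈ 𝔓.inertia (absoluteGaloisGroup ℚ), ψ σ = 1)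
    (hψF : ∀ v : HeightOneSpectrum (𝓞 ℚ), ¬ ((primesEquiv v : Nat.Primes) : ℕ) ∣ m →
      ∀ 𝔓 ∈ v.primesAbove, ∀ σ : absoluteGaloisGroup ℚ, IsArithFrobAt (𝓞 ℚ) σ 𝔓 →
        (ψ σ : PadicAlgCl ℓ) = ι.symm (χ₀ (primesEquiv v : ℕ)))
    {Ng : ℕ} [NeZero Ng] (g : CuspForm (Gamma1 Ng) 2) {T₀ : ℕ} (hT₀ : T₀ ≠ 0)
    (hg : ∀ p : ℕ, p.Prime → ¬ p ∣ T₀ →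
      cuspCoeff g p = χ₀ p * (W.LFunction p : ℂ) ∧ (nebentypus g (p : ZMod Ng) : ℂ) = χ₀ p ^ 2)
    (ρg : FramedGaloisRep ℚ (PadicAlgCl ℓ) 2)
    (hρg : IsGaloisRepOfNewform1 g
      ((ι.symm : ℂ →+* PadicAlgCl ℓ).comp (algebraMap (coeffCharField g) ℂ)) {q | q ∣ Ng * ℓ} ρg)
    (hirr : ρg.toGaloisRep.IsIrreducible) :
    Nonempty (ContinuousRep.Equiv ρg.toGaloisRep
      (FramedGaloisRep.toGaloisRep ((VQ.baseChange (algebraMap ℚ_[ℓ] (PadicAlgCl ℓ))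
        (continuous_algebraMap_padicAlgCl ℓ)).twist ψ))) := by
  classical
  have hℓp : ℓ.Prime := Fact.out
  set iE := algebraMap ℚ_[ℓ] (PadicAlgCl ℓ) with hiE
  -- the exceptional set
  set M := m * T₀ * Ng * ℓ with hM
  have hM0 : M ≠ 0 :=
    mul_ne_zero (mul_ne_zero (mul_ne_zero (NeZero.ne m) hT₀) (NeZero.ne Ng)) hℓp.ne_zero
  set S : Set (HeightOneSpectrum (𝓞 ℚ)) :=
    {v | ¬ W.HasGoodReductionAt v} ∪ {v | ((primesEquiv v : Nat.Primes) : ℕ) ∣ M} with hSdef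
  have hfinM : {v : HeightOneSpectrum (𝓞 ℚ) | ((primesEquiv v : Nat.Primes) : ℕ) ∣ M}.Finite := by
    have h0 : ((Subtype.val : Nat.Primes → ℕ) ⁻¹' (↑(Nat.divisors M) : Set ℕ)).Finite :=
      Set.Finite.preimage Subtype.val_injective.injOn (Finset.finite_toSet _)
    have h1 : {q : Nat.Primes | (q : ℕ) ∣ M}.Finite := by
      refine h0.subset fun q hq => ?_
      simp only [Set.mem_preimage, Finset.mem_coe, Nat.mem_divisors]
      exact ⟨hq, hM0⟩
    exact Set.Finite.preimage (f := ⇑(primesEquiv (R := 𝓞 ℚ)))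
      (s := {q : Nat.Primes | (q : ℕ) ∣ M}) primesEquiv.injective.injOn h1
  have hS : S.Finite :=
    (Filter.eventually_cofinite.mp W.eventually_hasGoodReductionAt).union hfinM
  refine FramedGaloisRep.nonempty_equiv_of_hasFrobCharpolyAt_of_finite_of_isIrreducible hS ρg _
    hirr fun v hv ↦ ?_
  simp only [hSdef, Set.mem_union, Set.mem_setOf_eq, not_or, not_not] at hv
  obtain ⟨hgood, hndvd⟩ := hv
  set p : ℕ := ((primesEquiv v : Nat.Primes) : ℕ) with hpdef
  have hp : p.Prime := (primesEquiv v).2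
  have hpm : ¬ p ∣ m := fun h => hndvd (h.trans ⟨T₀ * Ng * ℓ, by rw [hM]; ring⟩)
  have hpT : ¬ p ∣ T₀ := fun h => hndvd (h.trans ⟨m * Ng * ℓ, by rw [hM]; ring⟩)
  have hpN : ¬ p ∣ Ng := fun h => hndvd (h.trans ⟨m * T₀ * ℓ, by rw [hM]; ring⟩)
  have hpℓ : p ≠ ℓ := fun h => hndvd ⟨m * T₀ * Ng, by rw [hM, ← h]; ring⟩
  have hmemv : ∀ n : ℕ, (n : 𝓞 ℚ) ∈ v.asIdeal ↔ p ∣ n := fun n => by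
    rw [hpdef, show ((primesEquiv v : Nat.Primes) : ℕ) = natGenerator v from rfl,
      natGenerator_dvd_iff, ← map_natCast (Rat.IsIntegralClosure.intEquiv (𝓞 ℚ)) n,
      Ideal.apply_mem_of_equiv_iff]
  have hℓv : (ℓ : 𝓞 ℚ) ∉ v.asIdeal := by
    rw [hmemv]
    intro h
    exact hpℓ ((Nat.prime_dvd_prime_iff_eq hp hℓp).mp h)
  obtain ⟨hVu, hVf⟩ := hV v hℓv hgood
  -- the common Frobenius polynomial
  set c : PadicAlgCl ℓ := ι.symm (χ₀ p) with hc
  set P : (PadicAlgCl ℓ)[X] :=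
    X ^ 2 - C (c * ((W.LFunction p : ℤ) : PadicAlgCl ℓ)) * X + C (c ^ 2 * (p : PadicAlgCl ℓ))
    with hPdef
  refine ⟨?_, ?_, P, ?_, ?_⟩
  · -- `ρ_g` unramified at `p ∤ N_g ℓ`
    refine (hρg v ?_).1
    simp only [Set.mem_setOf_eq]
    intro h
    rcases (Nat.Prime.dvd_mul hp).mp h with h1 | h1
    · exact hpN h1
    · exact hpℓ ((Nat.prime_dvd_prime_iff_eq hp hℓp).mp h1)
  · -- the twist is unramified
    exact FramedGaloisRep.isUnramifiedAt_twist
      ((FramedGaloisRep.isUnramifiedAt_baseChange_iff iE (continuous_algebraMap_padicAlgCl ℓ)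
        (algebraMap ℚ_[ℓ] (PadicAlgCl ℓ)).injective v VQ).mpr hVu) (hψI v hpm)
  · -- Frobenius polynomial of `ρ_g`
    have hvS : ((primesEquiv v : Nat.Primes) : ℕ) ∉ {q | q ∣ Ng * ℓ} := by
      simp only [Set.mem_setOf_eq]
      intro h
      rcases (Nat.Prime.dvd_mul hp).mp h with h1 | h1
      · exact hpN h1
      · exact hpℓ ((Nat.prime_dvd_prime_iff_eq hp hℓp).mp h1)
    have hgf := (hρg v hvS).2
    have hmap : (heckePolynomial g p).map
        ((ι.symm : ℂ →+* PadicAlgCl ℓ).comp (algebraMap (coeffCharField g) ℂ)) = P := by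
      obtain ⟨hga, hge⟩ := hg p hp hpT
      rw [← Polynomial.map_map, map_heckePolynomial, cuspCoeff] at *
      rw [hga, hge, hPdef]
      have h21 : ((2 : ℤ) - 1) = 1 := by norm_num
      simp [h21, hc]
    rw [← hmap]
    exact hgf
  · -- Frobenius polynomial of the twist
    have hVf' := FramedGaloisRep.hasFrobCharpolyAt_baseChange iE
      (continuous_algebraMap_padicAlgCl ℓ) hVf
    have hmapQ : (X ^ 2 - C ((W.LFunction p : ℤ) : ℚ_[ℓ]) * X + C (p : ℚ_[ℓ]) : ℚ_[ℓ][X]).map iE =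
        X ^ 2 - C ((W.LFunction p : ℤ) : PadicAlgCl ℓ) * X + C (p : PadicAlgCl ℓ) := by
      simp
    rw [hmapQ] at hVf'
    have key := FramedGaloisRep.hasFrobCharpolyAt_twist_two hVf' (χ := ψ) (c := c)
      (fun 𝔓 h𝔓 σ hσ => by rw [hc]; exact hψF v hpm 𝔓 h𝔓 σ hσ)
    rw [hPdef]
    exact key

/-- **The Euler factors of `V_ℓ(E) ⊗ ψ` are those of the twisted newform, at every `p ≠ ℓ`
(modulo Carayol).**  In the situation of `nonempty_equiv_twist_of_isGaloisRepOfNewform1`, with `g`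
a newform, assume Carayol's theorem in Euler-factor form (hypothesis `hC`: for every newform of
weight `k ≥ 2`, every irreducible `ℓ`-adic representation attached to it and every prime `p ≠ ℓ`,
`det(1 - Frob T | (ρ_g)_{I_𝔓}) = ι⁻¹(1 - a_p(g) T + ε_g(p) p^{k-1} T²)` — Carayol 1986,
Thm. (A), read on `L`-factors; Rohrlich 1997, §3.1 and §3.8 Thm. 5).  Then for every prime
`p ≠ ℓ`, every prime `𝔓 ∣ p` of `ℤ̄` and every arithmetic Frobenius `σ ∈ D_𝔓`, the reversed
characteristic polynomial of `σ` on the inertia coinvariants of `(V_ℓ(E) ⊗ ℚ̄_ℓ) ⊗ ψ` is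
`1 - a_p(g) T + ε_g(p) p T²` (read in `ℂ` through `ι`): the two representations are isomorphic,
and isomorphic representations have the same coinvariant Euler factors.
[cite: CarayolASENS1986, Thm. (A) (0.7) with (0.5), (0.8), pp. 410–411]
[cite: Rohrlich1997, §3.1 (PDF pp. 131–132) and §3.8 Thm. 5 (PDF p. 152)] -/
theorem map_reverse_charpoly_toInertiaCoinvariants_twist_eq (W : WeierstrassCurve ℚ) [W.IsElliptic]
    (ℓ : ℕ) [Fact ℓ.Prime] (ι : PadicAlgCl ℓ ≃+* ℂ) (VQ : FramedGaloisRep ℚ ℚ_[ℓ] 2)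
    (hV : ∀ v : HeightOneSpectrum (𝓞 ℚ), (ℓ : 𝓞 ℚ) ∉ v.asIdeal → W.HasGoodReductionAt v →
      FramedGaloisRep.IsUnramifiedAt v VQ ∧
        FramedGaloisRep.HasFrobCharpolyAt v
          (X ^ 2 - C ((W.LFunction (primesEquiv v : ℕ) : ℤ) : ℚ_[ℓ]) * X +
            C ((primesEquiv v : ℕ) : ℚ_[ℓ])) VQ)
    (m : ℕ) [NeZero m] (χ₀ : ℕ → ℂ) (ψ : absoluteGaloisGroup ℚ →ₜ* (PadicAlgCl ℓ)ˣ)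
    (hψI : ∀ v : HeightOneSpectrum (𝓞 ℚ), ¬ ((primesEquiv v : Nat.Primes) : ℕ) ∣ m →
      ∀ 𝔓 ∈ v.primesAbove, ∀ σ ∈ 𝔓.inertia (absoluteGaloisGroup ℚ), ψ σ = 1)
    (hψF : ∀ v : HeightOneSpectrum (𝓞 ℚ), ¬ ((primesEquiv v : Nat.Primes) : ℕ) ∣ m →
      ∀ 𝔓 ∈ v.primesAbove, ∀ σ : absoluteGaloisGroup ℚ, IsArithFrobAt (𝓞 ℚ) σ 𝔓 →
        (ψ σ : PadicAlgCl ℓ) = ι.symm (χ₀ (primesEquiv v : ℕ)))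
    {Ng : ℕ} [NeZero Ng] (g : CuspForm (Gamma1 Ng) 2) (hgk : IsNewform1 g) {T₀ : ℕ} (hT₀ : T₀ ≠ 0)
    (hg : ∀ p : ℕ, p.Prime → ¬ p ∣ T₀ →
      cuspCoeff g p = χ₀ p * (W.LFunction p : ℂ) ∧ (nebentypus g (p : ZMod Ng) : ℂ) = χ₀ p ^ 2)
    (ρg : FramedGaloisRep ℚ (PadicAlgCl ℓ) 2)
    (hρg : IsGaloisRepOfNewform1 g
      ((ι.symm : ℂ →+* PadicAlgCl ℓ).comp (algebraMap (coeffCharField g) ℂ)) {q | q ∣ Ng * ℓ} ρg)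
    (hirr : ρg.toGaloisRep.IsIrreducible)
    (hC : ∀ {N : ℕ} [NeZero N] {k : ℤ} (g : CuspForm (Gamma1 N) k), 2 ≤ k → IsNewform1 g →
      ∀ (p : ℕ) [Fact p.Prime] (ι : PadicAlgCl p ≃+* ℂ) (ρ : FramedGaloisRep ℚ (PadicAlgCl p) 2),
        IsGaloisRepOfNewform1 g
          ((ι.symm : ℂ →+* PadicAlgCl p).comp (algebraMap (coeffCharField g) ℂ))
            {q | q ∣ N * p} ρ →
        ρ.toGaloisRep.IsIrreducible →
      ∀ ℓ : ℕ, ℓ.Prime → ℓ ≠ p →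
      ∀ w : HeightOneSpectrum (𝓞 ℚ), (ℓ : 𝓞 ℚ) ∈ w.asIdeal → ∀ 𝔔 ∈ w.primesAbove,
      ∀ σ : 𝔔.decompositionSubgroup (absoluteGaloisGroup ℚ),
        IsArithFrobAt (𝓞 ℚ) (σ : absoluteGaloisGroup ℚ) 𝔔 →
        (ρ.toGaloisRep.toInertiaCoinvariants 𝔔 σ).charpoly.reverse =
          1 - C (ι.symm (cuspCoeff g ℓ)) * X +
            C (ι.symm ((nebentypus g (ℓ : ZMod N) : ℂ) * (ℓ : ℂ) ^ (k - 1))) * X ^ 2)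
    {w : HeightOneSpectrum (𝓞 ℚ)} (hw : (ℓ : 𝓞 ℚ) ∉ w.asIdeal)
    {𝔔 : Ideal (absIntegers (𝓞 ℚ) ℚ)} (h𝔔 : 𝔔 ∈ w.primesAbove)
    (σ : 𝔔.decompositionSubgroup (absoluteGaloisGroup ℚ))
    (hσ : IsArithFrobAt (𝓞 ℚ) (σ : absoluteGaloisGroup ℚ) 𝔔) :
    ((ContinuousRep.toInertiaCoinvariants (FramedGaloisRep.toGaloisRep
        ((VQ.baseChange (algebraMap ℚ_[ℓ] (PadicAlgCl ℓ)) (continuous_algebraMap_padicAlgCl ℓ)).twist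
          ψ)) 𝔔 σ).charpoly.reverse).map (ι : PadicAlgCl ℓ →+* ℂ) =
      1 - C (cuspCoeff g (primesEquiv w : ℕ)) * X +
        C ((nebentypus g ((primesEquiv w : ℕ) : ZMod Ng) : ℂ) * ((primesEquiv w : ℕ) : ℂ)) *
          X ^ 2 := by
  have hℓp : ℓ.Prime := Fact.out
  set p : ℕ := ((primesEquiv w : Nat.Primes) : ℕ) with hpdef
  have hp : p.Prime := (primesEquiv w).2
  haveI : Fact p.Prime := ⟨hp⟩
  have hmemw : ∀ n : ℕ, (n : 𝓞 ℚ) ∈ w.asIdeal ↔ p ∣ n := fun n => by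
    rw [hpdef, show ((primesEquiv w : Nat.Primes) : ℕ) = natGenerator w from rfl,
      natGenerator_dvd_iff, ← map_natCast (Rat.IsIntegralClosure.intEquiv (𝓞 ℚ)) n,
      Ideal.apply_mem_of_equiv_iff]
  have hpw : (p : 𝓞 ℚ) ∈ w.asIdeal := (hmemw p).mpr dvd_rfl
  have hpℓ : p ≠ ℓ := by
    intro h
    apply hw
    rw [← h]
    exact hpw
  obtain ⟨e⟩ := nonempty_equiv_twist_of_isGaloisRepOfNewform1 W ℓ ι VQ hV m χ₀ ψ hψI hψF g hT₀ hg
    ρg hρg hirr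
  -- isomorphic representations have the same coinvariant Euler factors
  have he : ∀ (γ : absoluteGaloisGroup ℚ) (x : Fin 2 → PadicAlgCl ℓ),
      e.toLinearEquiv (ρg.toGaloisRep γ x) = (FramedGaloisRep.toGaloisRep
        ((VQ.baseChange (algebraMap ℚ_[ℓ] (PadicAlgCl ℓ)) (continuous_algebraMap_padicAlgCl ℓ)).twist
          ψ)) γ (e.toLinearEquiv x) :=
    fun γ x => LinearMap.congr_fun (e.isIntertwining' γ) x
  have hconj := ContinuousRep.inertiaCoinvariantsCongr_conj_toInertiaCoinvariants _ _
    e.toLinearEquiv he 𝔔 σ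
  rw [← hconj, LinearEquiv.charpoly_conj, hC g le_rfl hgk ℓ ι ρg hρg hirr p hp hpℓ w hpw 𝔔 h𝔔 σ hσ]
  have h21 : ((2 : ℤ) - 1) = 1 := by norm_num
  simp only [Polynomial.map_add, Polynomial.map_sub, Polynomial.map_mul, Polynomial.map_pow,
    Polynomial.map_one, map_X, map_C, RingEquiv.coe_toRingHom, RingEquiv.apply_symm_apply, h21,
    zpow_one]

end Identification

end Literature.NumberTheory.EllipticCurves

end
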